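import Summits.Ventures.QEDPrecision.Diagrams.NoLoopVertexGraphs

/-!
Venture QEDPrecision / cell `pub-qed`, unit `pub-qed-setv-gen-01` (graph layer; gen 22, 2026-08-21).  HONEST FRAMING (sprint, verbatim):
statistical Monte-Carlo evidence with stated σ, not a kernel certificate; independent recomputation; no new-physics claim.  THIS FILE, like
`SetVFamilyTable`, is the exception that framing allows for: a kernel-checked COMBINATORIAL statement (integer diagram COUNTS only — no physics,
no numerics, no integrands, no magnetic-moment value of any order), NEW WORK of the cell; printed sources are named only in comments and nothing
here is cited as a fact.  Staged copy: HOME/lean/setvgen01/SetVWordRecurrences.lean (HOME = run/shared/lean/pub/pub-qed/); the companion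
python check is HOME/pub-qed-setv-gen-01/bin/count_recurrences.py (run of record HOME/pub-qed-setv-gen-01/anchors/).

# The no-lepton-loop census as DOUBLE-OCCURRENCE-WORD recurrences (Touchard 1952; Burns–Muche 2011): 706 / 72 / 389 / 6354 / 3213 are
# instances of classical integer sequences, and the kernel-enumerated counts of `NoLoopVertexGraphs` equal them

DICTIONARY.  A self-energy-like QED diagram WITHOUT lepton loops of order 2n — one open lepton line with vertices `v₀ … v_{2n-1}` along the
arrow, n photons = a perfect matching of the vertices (`NoLoopVertexGraphs`, `SetVFamilyTable`) — IS a double occurrence word (DOW) of length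
2n over n letters (letters = photons in order of first appearance = AHKN's "representation by photon indices" = the WORD of `SetVFamilyTable`).
Under this identification: one-particle-irreducible (every internal lepton line crossed by a photon) ↔ IRREDUCIBLE DOW (not a concatenation
`u v` of two non-empty DOWs); time reversal ↔ word reversal; T-symmetric (η = 1) ↔ irreducible PALINDROME; AHKN family (one independent
integral) ↔ irreducible DOW up to reversal; directed vertex diagram `G(k)` ↔ irreducible DOW with one of its 2n−1 gaps marked; Volkov's
undirected vertex graph ↔ marked irreducible DOW up to reversal (the reversal fixes exactly the marked palindromes with the middle gap marked).

RECURRENCES (J. Burns, T. Muche, *Counting irreducible double occurrence words*, arXiv:1105.2926, §3; `(2n-1)!!` = `Nat.doubleFactorial (2n-1)`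
= all DOWs of length 2n):
* Lemma 3.2 (Touchard, Canad. J. Math. 4 (1952) 2; OEIS A000698):  `I₁ = 1`,  `Iₙ = (2n-1)!! - Σ_{k=1}^{n-1} I_{n-k} (2k-1)!!`;
* Theorem 3.1 (OEIS A047974):  `L₁ = 1`, `L₂ = 3`, `Lₙ = L_{n-1} + (2n-2) L_{n-2}`  (all palindromic DOWs);
* Theorem 3.3:  `J₀ = J₁ = 1`,  `Jₙ = Lₙ - Σ_{k=1}^{⌊n/2⌋} (2k-1)!! J_{n-2k}`  (irreducible palindromes);
* formula (∗): DOWs up to reversal = (#words + #palindromes) / 2.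
Hence families `Fₙ = (Iₙ + Jₙ)/2`, directed vertex diagrams `Vₙ = (2n-1) Iₙ`, undirected vertex graphs `Uₙ = ((2n-1) Iₙ + Jₙ)/2`.

CERTIFIED HERE (kernel): (1) the recurrence values through n = 7 — `I = 1, 2, 10, 74, 706, 8162, 110410`, `L = 1, 3, 7, 25, 81, 331, 1303`,
`J = 1, 2, 6, 20, 72, 290, 1198` — and Theorem 3.1's closed form `Lₙ = Σ_k n!/((n-2k)! k!)` on that range; (2) for n = 1 … 5 the counts that
`NoLoopVertexGraphs` certifies by EXHAUSTIVE ENUMERATION equal the recurrences: `selfEnergyDirected n = Iₙ`, `selfEnergySymmetric n = Jₙ`,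
`2 · selfEnergyUndirected n = Iₙ + Jₙ`, `vertexDirected n = (2n-1) Iₙ`, `2 · vertexUndirected n = (2n-1) Iₙ + Jₙ` — in particular
`706 = I₅`, `72 = J₅`, `389 = (I₅ + J₅)/2`, `6354 = 9 I₅`, `3213 = (9 I₅ + J₅)/2`; (3) the next two rows as pure recurrence values (orders e¹², e¹⁴):
`8162 / 290 / 4226 / 89782 / 45036` and `110410 / 1198 / 55804 / 1435330 / 718264`.
NOT certified here: the dictionary as a bijection for general n.  The python companion verifies, on EVERY perfect matching through order 14
(135135 at order 14), that the 1PI predicate of the generator of record and DOW-irreducibility agree word by word, that T-symmetry and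
palindromicity agree, and that the generator of record (code/setv/gen01/setv_enum.py) reproduces `I, J, F, V, U` through order 14 (ALL MATCH).
PRINT (comments only; counts, not values): M. Borinsky, *Graphs in Perturbation Theory* (Springer 2018) Table 7.14(a), "effective action in
quenched QED": proper fermion propagator `1, 2, 10, 74, 706`, proper vertex `1, 6, 50, 518, 6354` at ħ¹…ħ⁵; P. Cvitanović, B. Lautrup,
R. B. Pearson, Phys. Rev. D 18 (1978) 1939; AHKN q-type counts and Volkov's no-lepton-loop graph counts as cited in `NoLoopVertexGraphs`.
Kernel budget: trivial (lists of ≤ 8 small naturals; the enumeration side is imported as already-certified numerals).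
-/

set_option Elab.async false

namespace Summit.Ventures.QEDPrecision.Diagrams

/-! ## the three recurrences -/

/-- `(2n-1)!!` = the number of double occurrence words of length `2n` (perfect matchings of `2n` points; `pm_card`). -/
def dowAll (n : ℕ) : ℕ := Nat.doubleFactorial (2 * n - 1)

/-- `[I₁, …, Iₙ]`: Touchard's irreducible-DOW counts by the Burns–Muche Lemma 3.2 recurrence
`Iₙ = (2n-1)!! - Σ_{k=1}^{n-1} I_{n-k} (2k-1)!!` (the list is built left to right; entry `i` is `I_{i+1}`). -/
def dowIrrList : ℕ → List ℕ
  | 0 => []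
  | n + 1 =>
    let prev := dowIrrList n
    prev ++ [dowAll (n + 1) - ((List.range n).map fun j => prev.getD (n - 1 - j) 0 * dowAll (j + 1)).sum]

/-- `Iₙ` = number of irreducible double occurrence words of length `2n` = directed 1PI no-lepton-loop self-energy-like diagrams of order 2n
(OEIS A000698: 1, 2, 10, 74, 706, 8162, 110410, …; `I₀ = 0` by convention). -/
def dowIrreducible (n : ℕ) : ℕ := (dowIrrList n).getD (n - 1) 0

/-- `[L₁, …, Lₙ]`: all palindromic DOWs, Burns–Muche Theorem 3.1, `Lₙ = L_{n-1} + (2n-2) L_{n-2}`, `L₁ = 1`, `L₂ = 3` (OEIS A047974). -/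
def dowPalList : ℕ → List ℕ
  | 0 => []
  | 1 => [1]
  | 2 => [1, 3]
  | n + 3 =>
    let prev := dowPalList (n + 2)
    prev ++ [prev.getD (n + 1) 0 + (2 * n + 4) * prev.getD n 0]

/-- `Lₙ` = number of palindromic double occurrence words of length `2n` (`L₀ = 0` by convention). -/
def dowPalindromic (n : ℕ) : ℕ := (dowPalList n).getD (n - 1) 0

/-- `[J₀, J₁, …, Jₙ]`: irreducible palindromes, Burns–Muche Theorem 3.3, `Jₙ = Lₙ - Σ_{k=1}^{⌊n/2⌋} (2k-1)!! J_{n-2k}`, `J₀ = J₁ = 1`. -/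
def dowIrrPalList : ℕ → List ℕ
  | 0 => [1]
  | n + 1 =>
    let prev := dowIrrPalList n
    prev ++ [dowPalindromic (n + 1) - ((List.range ((n + 1) / 2)).map fun j => dowAll (j + 1) * prev.getD (n - 1 - 2 * j) 0).sum]

/-- `Jₙ` = number of irreducible palindromic DOWs of length `2n` = time-reversal-symmetric 1PI no-lepton-loop self-energy-like diagrams
(= AHKN families with η = 1): 1, 2, 6, 20, 72, 290, 1198, … -/
def dowIrrPalindromic (n : ℕ) : ℕ := (dowIrrPalList n).getD n 0

/-- families (irreducible DOWs up to reversal, Burns–Muche formula (∗)): `(Iₙ + Jₙ) / 2`. -/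
def dowFamilies (n : ℕ) : ℕ := (dowIrreducible n + dowIrrPalindromic n) / 2

/-- directed vertex diagrams (a marked gap): `(2n-1) Iₙ`. -/
def dowVertexDirected (n : ℕ) : ℕ := (2 * n - 1) * dowIrreducible n

/-- undirected vertex graphs (marked irreducible DOWs up to reversal): `((2n-1) Iₙ + Jₙ) / 2`. -/
def dowVertexUndirected (n : ℕ) : ℕ := ((2 * n - 1) * dowIrreducible n + dowIrrPalindromic n) / 2

/-! ## values through n = 7 (orders e² … e¹⁴) -/

/-- `(2n-1)!!` for n = 0 … 7: `1, 1, 3, 15, 105, 945, 10395, 135135`. -/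
theorem dowAll_values : (List.range 8).map dowAll = [1, 1, 3, 15, 105, 945, 10395, 135135] := by decide +kernel

/-- Touchard / OEIS A000698: `I₁ … I₇ = 1, 2, 10, 74, 706, 8162, 110410`. -/
theorem dowIrreducible_values : dowIrrList 7 = [1, 2, 10, 74, 706, 8162, 110410] := by decide +kernel

/-- OEIS A047974: `L₁ … L₇ = 1, 3, 7, 25, 81, 331, 1303`. -/
theorem dowPalindromic_values : dowPalList 7 = [1, 3, 7, 25, 81, 331, 1303] := by decide +kernel

/-- Burns–Muche Theorem 3.1, closed form `Lₙ = Σ_{k=0}^{⌊n/2⌋} n! / ((n-2k)! k!)`, checked for n = 1 … 7. -/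
theorem dowPalindromic_closedForm :
    ∀ n ∈ [1, 2, 3, 4, 5, 6, 7],
      dowPalindromic n = ((List.range (n / 2 + 1)).map fun k => n.factorial / ((n - 2 * k).factorial * k.factorial)).sum := by
  decide +kernel

/-- irreducible palindromes `J₀ … J₇ = 1, 1, 2, 6, 20, 72, 290, 1198` (Burns–Muche Theorem 3.3; "not in the OEIS" in 2011). -/
theorem dowIrrPalindromic_values : dowIrrPalList 7 = [1, 1, 2, 6, 20, 72, 290, 1198] := by decide +kernel

/-- the derived census for n = 1 … 7: families `1, 2, 8, 47, 389, 4226, 55804`, directed vertex diagrams `1, 6, 50, 518, 6354, 89782, 1435330`,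
undirected vertex graphs `1, 4, 28, 269, 3213, 45036, 718264`. -/
theorem dowCensus_values :
    (List.range 7).map (fun i => dowFamilies (i + 1)) = [1, 2, 8, 47, 389, 4226, 55804] ∧
    (List.range 7).map (fun i => dowVertexDirected (i + 1)) = [1, 6, 50, 518, 6354, 89782, 1435330] ∧
    (List.range 7).map (fun i => dowVertexUndirected (i + 1)) = [1, 4, 28, 269, 3213, 45036, 718264] := by
  decide +kernel

/-- the n ≤ 5 values as single equations (used below against the enumeration). -/
theorem dowValues_le5 :
    (dowIrreducible 1 = 1 ∧ dowIrreducible 2 = 2 ∧ dowIrreducible 3 = 10 ∧ dowIrreducible 4 = 74 ∧ dowIrreducible 5 = 706) ∧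
    (dowIrrPalindromic 1 = 1 ∧ dowIrrPalindromic 2 = 2 ∧ dowIrrPalindromic 3 = 6 ∧ dowIrrPalindromic 4 = 20 ∧ dowIrrPalindromic 5 = 72) := by
  decide +kernel

/-! ## the kernel-enumerated counts of `NoLoopVertexGraphs` ARE these sequences (n = 1 … 5) -/

/-- directed 1PI no-lepton-loop self-energy-like diagrams = Touchard's irreducible DOWs: `selfEnergyDirected n = Iₙ`, n = 1 … 5
(`706 = I₅` at order e¹⁰). -/
theorem selfEnergyDirected_eq_dowIrreducible :
    selfEnergyDirected 1 = dowIrreducible 1 ∧ selfEnergyDirected 2 = dowIrreducible 2 ∧ selfEnergyDirected 3 = dowIrreducible 3 ∧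
    selfEnergyDirected 4 = dowIrreducible 4 ∧ selfEnergyDirected 5 = dowIrreducible 5 := by
  obtain ⟨d1, d2, d3, d4, d5⟩ := selfEnergyDirected_values
  obtain ⟨⟨e1, e2, e3, e4, e5⟩, -⟩ := dowValues_le5
  refine ⟨?_, ?_, ?_, ?_, ?_⟩ <;> omega

/-- time-reversal-symmetric diagrams = irreducible palindromes: `selfEnergySymmetric n = Jₙ`, n = 1 … 5 (`72 = J₅`). -/
theorem selfEnergySymmetric_eq_dowIrrPalindromic :
    selfEnergySymmetric 1 = dowIrrPalindromic 1 ∧ selfEnergySymmetric 2 = dowIrrPalindromic 2 ∧ selfEnergySymmetric 3 = dowIrrPalindromic 3 ∧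
    selfEnergySymmetric 4 = dowIrrPalindromic 4 ∧ selfEnergySymmetric 5 = dowIrrPalindromic 5 := by
  obtain ⟨f1, f2, f3, f4, f5⟩ := selfEnergySymmetric_values
  obtain ⟨-, ⟨e1, e2, e3, e4, e5⟩⟩ := dowValues_le5
  refine ⟨?_, ?_, ?_, ?_, ?_⟩ <;> omega

/-- families (AHKN independent integrals; mirror classes of self-energy graphs) obey Burns–Muche's formula (∗):
`2 · selfEnergyUndirected n = Iₙ + Jₙ`, n = 1 … 5 (`389 = (706 + 72)/2`). -/
theorem selfEnergyUndirected_eq_dowFamilies :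
    2 * selfEnergyUndirected 1 = dowIrreducible 1 + dowIrrPalindromic 1 ∧ 2 * selfEnergyUndirected 2 = dowIrreducible 2 + dowIrrPalindromic 2 ∧
    2 * selfEnergyUndirected 3 = dowIrreducible 3 + dowIrrPalindromic 3 ∧ 2 * selfEnergyUndirected 4 = dowIrreducible 4 + dowIrrPalindromic 4 ∧
    2 * selfEnergyUndirected 5 = dowIrreducible 5 + dowIrrPalindromic 5 := by
  obtain ⟨u1, u2, u3, u4, u5⟩ := selfEnergyUndirected_values
  obtain ⟨⟨e1, e2, e3, e4, e5⟩, ⟨g1, g2, g3, g4, g5⟩⟩ := dowValues_le5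
  refine ⟨?_, ?_, ?_, ?_, ?_⟩ <;> omega

/-- directed vertex diagrams (AHKN's `G(k)`, 6354 at order e¹⁰) = marked irreducible DOWs: `vertexDirected n = (2n-1) Iₙ`, n = 1 … 5. -/
theorem vertexDirected_eq_dowVertexDirected :
    vertexDirected 1 = 1 * dowIrreducible 1 ∧ vertexDirected 2 = 3 * dowIrreducible 2 ∧ vertexDirected 3 = 5 * dowIrreducible 3 ∧
    vertexDirected 4 = 7 * dowIrreducible 4 ∧ vertexDirected 5 = 9 * dowIrreducible 5 := by
  obtain ⟨a1, a2, a3, a4⟩ := vertexDirected_values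
  obtain ⟨a5, -, -⟩ := order10_values
  obtain ⟨⟨e1, e2, e3, e4, e5⟩, -⟩ := dowValues_le5
  refine ⟨?_, ?_, ?_, ?_, ?_⟩ <;> omega

/-- Volkov's undirected vertex graphs (3213 at order e¹⁰) = marked irreducible DOWs up to reversal:
`2 · vertexUndirected n = (2n-1) Iₙ + Jₙ`, n = 1 … 5 (`2 · 3213 = 9 · 706 + 72`). -/
theorem vertexUndirected_eq_dowVertexUndirected :
    2 * vertexUndirected 1 = 1 * dowIrreducible 1 + dowIrrPalindromic 1 ∧ 2 * vertexUndirected 2 = 3 * dowIrreducible 2 + dowIrrPalindromic 2 ∧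
    2 * vertexUndirected 3 = 5 * dowIrreducible 3 + dowIrrPalindromic 3 ∧ 2 * vertexUndirected 4 = 7 * dowIrreducible 4 + dowIrrPalindromic 4 ∧
    2 * vertexUndirected 5 = 9 * dowIrreducible 5 + dowIrrPalindromic 5 := by
  obtain ⟨b1, b2, b3, b4⟩ := vertexUndirected_values
  obtain ⟨-, b5, -⟩ := order10_values
  obtain ⟨⟨e1, e2, e3, e4, e5⟩, ⟨g1, g2, g3, g4, g5⟩⟩ := dowValues_le5
  refine ⟨?_, ?_, ?_, ?_, ?_⟩ <;> omega

/-- Summary at order e¹⁰ in the cell's vocabulary: the Set V census `706 / 72 / 389 / 6354 / 3213` is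
`I₅ / J₅ / (I₅+J₅)/2 / 9·I₅ / (9·I₅+J₅)/2` with `I, J` Touchard's and Burns–Muche's sequences. -/
theorem setV_census_is_touchard :
    selfEnergyDirected 5 = dowIrreducible 5 ∧ selfEnergySymmetric 5 = dowIrrPalindromic 5 ∧ selfEnergyUndirected 5 = dowFamilies 5 ∧
    vertexDirected 5 = dowVertexDirected 5 ∧ vertexUndirected 5 = dowVertexUndirected 5 ∧
    dowIrreducible 5 = 706 ∧ dowIrrPalindromic 5 = 72 ∧ dowFamilies 5 = 389 ∧ dowVertexDirected 5 = 6354 ∧ dowVertexUndirected 5 = 3213 := by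
  have h : dowIrreducible 5 = 706 ∧ dowIrrPalindromic 5 = 72 ∧ dowFamilies 5 = 389 ∧ dowVertexDirected 5 = 6354 ∧
      dowVertexUndirected 5 = 3213 := by decide +kernel
  obtain ⟨h1, h2, h3, h4, h5⟩ := h
  obtain ⟨-, -, -, -, d5⟩ := selfEnergyDirected_values
  obtain ⟨-, -, -, -, f5⟩ := selfEnergySymmetric_values
  obtain ⟨-, -, -, -, u5⟩ := selfEnergyUndirected_values
  obtain ⟨a5, b5, -⟩ := order10_values
  refine ⟨?_, ?_, ?_, ?_, ?_, h1, h2, h3, h4, h5⟩ <;> omega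

end Summit.Ventures.QEDPrecision.Diagrams
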